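import Summits.FinalStateConjecture.FinalStateConjecture.Theorems.BartnikGapSettlingGapExhaustionLevelSweepDense
import Summits.FinalStateConjecture.FinalStateConjecture.Theorems.BartnikGapSettlingGapExhaustionKerrRadiusOuterCover
import Summits.FinalStateConjecture.FinalStateConjecture.Theorems.BartnikGapSettlingGapExhaustionKerrCoordKillingSweepSmooth
import HarnessLib

/-!
# Crux `GapExhaustion` (stmt-FinalStateConjecture-10808), line `photon-shell-pseudoconvexity`:
# stub `stub_kerrCoordKillingSweepSmoothOut` — the INWARD `C^∞` level-set sweep for COORDINATE
# KILLING FIELDS of a metric datum across the Kerr–Schild cylinders (data on the OUTER side)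

Route `BartnikGapSettling`; helper (`--supports stmt-FinalStateConjecture-10808`) of the line's
rigidity node. The node's inward sweep S3 extends the scri-side Killing field from the far zone
`{r > c₁}` inward across the cylinders `{r = c}`, `c` from `c₁` DOWN to `c₀`, the data always
living on the outer side `{r > c}` (Ionescu–Klainerman, JAMS 26 (2013), Thm 1.2 for the local
step; globalisation as in Alexakis–Ionescu–Klainerman, CMP 299 (2010), §6). This file is the
mirror image of the outward instance `stub_kerrCoordKillingSweepSmooth`: it instantiates the
landed CONVEXITY-FREE abstract level-set sweep `stub_levelSweepDense` with the level function
`f = −r`, `r = Kerr.radius a` (levels from `−c₁` up to `−c₀`, `{f < −c} = {c < r}`), the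
covering constant `C = 2`, and the same admissibility predicate as the outward instance,

  `P k U :⇔ ∃ U' open, U ⊆ U' ⊆ W, k ∈ C^∞(U') and DG(y)(k y)(Y,Z) + G y (Dk Y) Z + G y Y (Dk Z) = 0
   on U'`

("`k` is a `C^∞` Killing field on some open superset of `U` inside `W`"), whose four axioms
(restriction, locality on open sets, gluing over open families, unique continuation on connected
open sets via the §1e chain `stub_killingPatching_of ∘ stub_killingUniqueContinuation_of ∘ …`)
are discharged verbatim as there. The two geometric inputs at the level `−c`, `c ∈ [c₀, c₁]`,
`0 < c₀`, `|a| ≤ c₀` — density of `{f < −c} = {r > c}` at the points of the cylinder `{r = c}`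
and the linear covering estimate `dist(y, {r = c}) ≤ 2 (c − r(y))` for `y ∈ D`, `r(y) ≤ c`
(using `|a| ≤ r(y)`, `0 < r(y)` on the arena `D`) — are `stub_kerrRadius_outerCover`. The output
radius fed to the abstract sweep is `min ρ' ρ`, so that the output balls
`ball x (min ρ' ρ) ⊆ ball x ρ ⊆ D ⊆ W` stay inside the domain of the metric datum.
[folklore globalisation; cf. Alexakis–Ionescu–Klainerman, CMP 299 (2010), §6]
-/

noncomputable section

-- instance search through the nested operator types `E4 →L[ℝ] E4 →L[ℝ] E4 →L[ℝ] ℝ`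
set_option maxSynthPendingDepth 3

-- D-0017: single-problem summit, `Summit.<S>.<S>.…` by design (cf. lakefile `weak.linter.dupNamespace`).
set_option linter.dupNamespace false

namespace Summit.FinalStateConjecture.FinalStateConjecture.Theorems

open Set Metric
open Literature.Geometry.Lorentzian Literature.Geometry.Lorentzian.MetricCoord
open scoped Topology ContDiff

/-- **Stub `stub_kerrCoordKillingSweepSmoothOut` of the line `photon-shell-pseudoconvexity`
(crux `GapExhaustion`, stmt-FinalStateConjecture-10808) — the INWARD level-set sweep for `C^∞`
coordinate Killing fields across the Kerr–Schild cylinders.** Let `G` be a metric datum on the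
open set `W ⊆ E4`, `D ⊆ W` an open arena on which `|a| ≤ r` and `0 < r` (`r = Kerr.radius a`),
`0 < c₀ ≤ c₁`, `|a| ≤ c₀`, `0 < ρ`, `0 < ρ'`, such that for every level `c ∈ [c₀, c₁]` and every
point `x` of the cylinder `{r = c}` the ball `ball x ρ` lies in `D` and every `C^∞` Killing field
of `G` on the OUTER half-ball `ball x ρ ∩ {c < r}` is extended by a `C^∞` Killing field on
`ball x ρ'` (the uniform local extension property, Ionescu–Klainerman, JAMS 26 (2013), Thm 1.2).
Then every `C^∞` Killing field `k₀` of `G` on the far zone `D ∩ {c₁ < r}` is extended by a `C^∞`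
Killing field on `D ∩ {c₀ < r}`. Proof: the convexity-free abstract level-set sweep
`stub_levelSweepDense` for the predicate "`C^∞` Killing on an open superset inside `W`" (unique
continuation used at `C²` via `.of_le`), the level function `−Kerr.radius a` (`{−r < −c} =
{c < r}`; density at the level points and covering constant `2` from
`stub_kerrRadius_outerCover`), and output radius `min ρ' ρ`.
[folklore globalisation; cf. Alexakis–Ionescu–Klainerman, CMP 299 (2010), §6] -/
theorem stub_kerrCoordKillingSweepSmoothOut :
    ∀ (G : E4 → E4 →L[ℝ] E4 →L[ℝ] ℝ) (W D : Set E4) (a c₀ c₁ ρ ρ' : ℝ) (k₀ : E4 → E4),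
      IsMetricOn G W → IsOpen D → D ⊆ W → c₀ ≤ c₁ → 0 < c₀ → |a| ≤ c₀ → 0 < ρ' → 0 < ρ →
      (∀ y ∈ D, |a| ≤ Kerr.radius a y ∧ 0 < Kerr.radius a y) →
      (∀ c ∈ Icc c₀ c₁, ∀ x : E4, Kerr.radius a x = c → ball x ρ ⊆ D) →
      (∀ c ∈ Icc c₀ c₁, ∀ x : E4, Kerr.radius a x = c → ∀ k : E4 → E4,
        ContDiffOn ℝ ∞ k (ball x ρ ∩ {y | c < Kerr.radius a y}) →
        (∀ y ∈ ball x ρ ∩ {y | c < Kerr.radius a y}, ∀ Y Z : E4,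
          fderiv ℝ G y (k y) Y Z + G y (fderiv ℝ k y Y) Z + G y Y (fderiv ℝ k y Z) = 0) →
        ∃ k' : E4 → E4, ContDiffOn ℝ ∞ k' (ball x ρ') ∧
          (∀ y ∈ ball x ρ', ∀ Y Z : E4,
            fderiv ℝ G y (k' y) Y Z + G y (fderiv ℝ k' y Y) Z + G y Y (fderiv ℝ k' y Z) = 0) ∧
          EqOn k' k (ball x ρ' ∩ {y | c < Kerr.radius a y})) →
      ContDiffOn ℝ ∞ k₀ (D ∩ {y | c₁ < Kerr.radius a y}) →
      (∀ y ∈ D ∩ {y | c₁ < Kerr.radius a y}, ∀ Y Z : E4,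
        fderiv ℝ G y (k₀ y) Y Z + G y (fderiv ℝ k₀ y Y) Z + G y Y (fderiv ℝ k₀ y Z) = 0) →
      ∃ k : E4 → E4, ContDiffOn ℝ ∞ k (D ∩ {y | c₀ < Kerr.radius a y}) ∧
        (∀ y ∈ D ∩ {y | c₀ < Kerr.radius a y}, ∀ Y Z : E4,
          fderiv ℝ G y (k y) Y Z + G y (fderiv ℝ k y Y) Z + G y Y (fderiv ℝ k y Z) = 0) ∧
        EqOn k k₀ (D ∩ {y | c₁ < Kerr.radius a y}) := by
  intro G W D a c₀ c₁ ρ ρ' k₀ hG hD hDW hc hc₀ ha hρ' hρ hpos hball hloc hk₀ hkil₀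
  -- the admissibility predicate: `C^∞` Killing field of `G` on some open superset inside `W`
  let P : (E4 → E4) → Set E4 → Prop := fun k U ↦ ∃ U' : Set E4, IsOpen U' ∧ U ⊆ U' ∧ U' ⊆ W ∧
    ContDiffOn ℝ ∞ k U' ∧ ∀ y ∈ U', ∀ Y Z : E4,
      fderiv ℝ G y (k y) Y Z + G y (fderiv ℝ k y Y) Z + G y Y (fderiv ℝ k y Z) = 0
  -- (restriction)
  have hmono : ∀ (k : E4 → E4) (U V : Set E4), P k U → V ⊆ U → P k V := by
    rintro k U V ⟨U', hU'o, hUU', hU'W, hk, hkil⟩ hVU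
    exact ⟨U', hU'o, hVU.trans hUU', hU'W, hk, hkil⟩
  -- (locality on open sets)
  have hcongr : ∀ (k k' : E4 → E4) (U : Set E4), IsOpen U → EqOn k k' U → P k U → P k' U := by
    rintro k k' U hU heq ⟨U', _, hUU', hU'W, hk, hkil⟩
    refine ⟨U, hU, Subset.rfl, hUU'.trans hU'W, (hk.mono hUU').congr fun y hy ↦ (heq hy).symm,
      fun y hy Y Z ↦ ?_⟩
    have hev : k' =ᶠ[𝓝 y] k := heq.symm.eventuallyEq_of_mem (hU.mem_nhds hy)
    rw [hev.fderiv_eq, hev.eq_of_nhds]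
    exact hkil y (hUU' hy) Y Z
  -- (gluing over open families)
  have hunion : ∀ (k : E4 → E4) (ι : Type) (U : ι → Set E4), (∀ i, IsOpen (U i)) →
      (∀ i, P k (U i)) → P k (⋃ i, U i) := by
    intro k ι U _ hP
    choose U' hU'o hUU' hU'W hk hkil using hP
    refine ⟨⋃ i, U' i, isOpen_iUnion hU'o, iUnion_mono hUU', iUnion_subset hU'W,
      fun y hy ↦ ?_, fun y hy Y Z ↦ ?_⟩
    · obtain ⟨i, hi⟩ := mem_iUnion.1 hy
      exact ((hk i).contDiffAt ((hU'o i).mem_nhds hi)).contDiffWithinAt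
    · obtain ⟨i, hi⟩ := mem_iUnion.1 hy
      exact hkil i y hi Y Z
  -- (unique continuation on connected open sets: the §1e chain
  -- `stub_killingPatching_of ∘ stub_killingUniqueContinuation_of ∘ …` (O'Neill 1983, Ch. 9,
  -- Lemma 9.28, local form) on the metric datum restricted to `V`, `KerrSchildChart.isMetricOn_mono`)
  have hpatch : ∀ (k₁ k₂ : E4 → E4) (U V : Set E4), IsOpen V → IsConnected V → IsOpen U →
      U ⊆ V → U.Nonempty → P k₁ V → P k₂ V → EqOn k₁ k₂ U → EqOn k₁ k₂ V := by
    rintro k₁ k₂ U V hV hVc hU hUV hUne ⟨V₁, _, hVV₁, hV₁W, hk₁, hkil₁⟩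
      ⟨V₂, _, hVV₂, _, hk₂, hkil₂⟩ heq y hy
    exact stub_killingPatching_of
      (stub_killingUniqueContinuation_of
        (stub_killingProlongation_of stub_killingHessianSkew stub_killingHessianAlt
          stub_curvatureLikeAlgebra)
        stub_firstOrderVanishing stub_killingJetBound_of)
      G V U k₁ k₂ (KerrSchildChart.isMetricOn_mono hG hV (hVV₁.trans hV₁W)) hVc hU hUV hUne
      ((hk₁.mono hVV₁).of_le (ENat.LEInfty.out : (2 : ℕ∞ω) ≤ ∞))
      ((hk₂.mono hVV₂).of_le (ENat.LEInfty.out : (2 : ℕ∞ω) ≤ ∞)) (fun z hz ↦ hkil₁ z (hVV₁ hz))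
      (fun z hz ↦ hkil₂ z (hVV₂ hz)) (fun _ hz ↦ heq hz) y hy
  -- geometry of the level function `f = -r`, `r = Kerr.radius a`: `{f < -c} = {c < r}`
  have hf : Continuous fun y : E4 ↦ -Kerr.radius a y := (Kerr.continuous_radius a).neg
  have hgt : ∀ c : ℝ, IsOpen {y : E4 | c < Kerr.radius a y} := fun c ↦
    isOpen_lt continuous_const (Kerr.continuous_radius a)
  have hS : ∀ c : ℝ, {y : E4 | -Kerr.radius a y < -c} = {y | c < Kerr.radius a y} := fun c ↦
    Set.ext fun y ↦ by simp only [mem_setOf_eq, neg_lt_neg_iff]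
  have hIcc : ∀ c : ℝ, -c ∈ Icc (-c₁) (-c₀) → c ∈ Icc c₀ c₁ := fun c hc' ↦
    ⟨neg_le_neg_iff.1 hc'.2, neg_le_neg_iff.1 hc'.1⟩
  -- (density of `{c < r}` at the points of the cylinder `{r = c}`)
  have hdense : ∀ c' ∈ Icc (-c₁) (-c₀), ∀ x : E4, -Kerr.radius a x = c' →
      x ∈ closure {y : E4 | -Kerr.radius a y < c'} := by
    intro c' hc' x hx
    obtain ⟨c, rfl⟩ : ∃ c, c' = -c := ⟨-c', (neg_neg c').symm⟩
    have hc : c ∈ Icc c₀ c₁ := hIcc c hc'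
    rw [hS]
    exact (stub_kerrRadius_outerCover a c (hc₀.trans_le hc.1) (ha.trans hc.1)).2 x
      (neg_inj.1 hx)
  -- (the linear covering estimate above the level `-c`, i.e. below the cylinder `{r = c}`)
  have hcover : ∀ c' ∈ Icc (-c₁) (-c₀), ∀ y ∈ D, c' ≤ -Kerr.radius a y →
      ∃ x : E4, -Kerr.radius a x = c' ∧ ‖x - y‖ ≤ 2 * (-Kerr.radius a y - c') := by
    intro c' hc' y hyD hy
    obtain ⟨c, rfl⟩ : ∃ c, c' = -c := ⟨-c', (neg_neg c').symm⟩
    have hc : c ∈ Icc c₀ c₁ := hIcc c hc'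
    obtain ⟨x, hx, -, hxy⟩ := (stub_kerrRadius_outerCover a c (hc₀.trans_le hc.1)
      (ha.trans hc.1)).1 y (hpos y hyD).1 (hpos y hyD).2 (neg_le_neg_iff.1 hy)
    refine ⟨x, neg_inj.2 hx, ?_⟩
    rwa [show -Kerr.radius a y - -c = c - Kerr.radius a y by ring]
  -- (the `ρ`-balls around the level points lie in the arena)
  have hball' : ∀ c' ∈ Icc (-c₁) (-c₀), ∀ x : E4, -Kerr.radius a x = c' → ball x ρ ⊆ D := by
    intro c' hc' x hx
    obtain ⟨c, rfl⟩ : ∃ c, c' = -c := ⟨-c', (neg_neg c').symm⟩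
    exact hball c (hIcc c hc') x (neg_inj.1 hx)
  -- the output radius `ρ₁ = min ρ' ρ`, so that the output balls stay inside `D ⊆ W`
  set ρ₁ : ℝ := min ρ' ρ with hρ₁def
  have hρ₁ : 0 < ρ₁ := lt_min hρ' hρ
  have hloc' : ∀ c' ∈ Icc (-c₁) (-c₀), ∀ x : E4, -Kerr.radius a x = c' → ∀ k : E4 → E4,
      P k (ball x ρ ∩ {y | -Kerr.radius a y < c'}) →
      ∃ k' : E4 → E4, P k' (ball x ρ₁) ∧
        EqOn k' k (ball x ρ₁ ∩ {y | -Kerr.radius a y < c'}) := by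
    intro c' hc' x hx k hPk
    obtain ⟨c, rfl⟩ : ∃ c, c' = -c := ⟨-c', (neg_neg c').symm⟩
    have hc : c ∈ Icc c₀ c₁ := hIcc c hc'
    have hxc : Kerr.radius a x = c := neg_inj.1 hx
    rw [hS] at hPk ⊢
    obtain ⟨U', _, hsub, _, hk, hkil⟩ := hPk
    obtain ⟨k', hk', hkil', heq⟩ :=
      hloc c hc x hxc k (hk.mono hsub) fun y hy ↦ hkil y (hsub hy)
    have h₁ : ball x ρ₁ ⊆ ball x ρ' := ball_subset_ball (min_le_left _ _)
    have h₂ : ball x ρ₁ ⊆ ball x ρ := ball_subset_ball (min_le_right _ _)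
    exact ⟨k', ⟨ball x ρ₁, isOpen_ball, Subset.rfl, h₂.trans ((hball c hc x hxc).trans hDW),
      hk'.mono h₁, fun y hy ↦ hkil' y (h₁ hy)⟩,
      heq.mono (inter_subset_inter_left _ h₁)⟩
  -- the initial field, on the far zone `D ∩ {c₁ < r} = D ∩ {f < -c₁}`
  have hP₀ : P k₀ (D ∩ {y | -Kerr.radius a y < -c₁}) := by
    rw [hS]
    exact ⟨D ∩ {y | c₁ < Kerr.radius a y}, hD.inter (hgt c₁), Subset.rfl,
      inter_subset_left.trans hDW, hk₀, hkil₀⟩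
  -- sweep the levels of `f = -r` from `-c₁` up to `-c₀`
  obtain ⟨k, ⟨U', _, hsub, _, hk, hkil⟩, heq⟩ :=
    stub_levelSweepDense E4 P (fun y ↦ -Kerr.radius a y) D (-c₁) (-c₀) ρ ρ₁ 2 k₀ hmono hcongr
      hunion hpatch hf hD (neg_le_neg hc) hρ₁ two_pos hdense hcover hball' hloc' hP₀
  rw [hS] at hsub heq
  exact ⟨k, hk.mono hsub, fun y hy ↦ hkil y (hsub hy), heq⟩

end Summit.FinalStateConjecture.FinalStateConjecture.Theorems

end
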